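import Summits.BirchSwinnertonDyer.BirchSwinnertonDyer.Theorems.ClassRecordThreeEulerHalvesAtThreeResidualUpperBoundCartanEmptyDegreeIndepTransport
import HarnessLib

/-!
# Crux NUM `CartanOnePlaceDegreeLawAtThree` (item 24801), line `lattice`, stub (D3) `DescentNonsplitAtThree` — brick 1:
# the HECKE–PERIOD IDENTITY on a Cartan-level curve (Shimura §8.3 (8.3.2), exact form)

Seat `bsd-stepL-tam3-p1` g27 (LEAD of crux 24801; `--supports stmt-BirchSwinnertonDyer-24801 --as helper`). For a Cartan datum
`X : CartanLevelCurveData D M C`, an index `n` with finitely many cosets `Γ∖ι(O(n))` (`Γ = X.Gamma = ι(O¹)`), a weight-two form `F` on `Γ`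
with `T_n F = a·F` (the `hecke_eq` clause of `CartanParametrizationData`, as a function identity) and `γ ∈ Γ`: writing the coset
representatives `α_q` (`q.out`) and `α_q γ = δ_q α_{e(q)}` with `δ_q ∈ Γ`, `e` a permutation of the coset space (right multiplication by `γ`),
**`a · ∫_z^{γz} F = Σ_q ∫_z^{δ_q z} F`** — EXACTLY, not only modulo a period group (`period_smul_eq_sum`). This is the computation inside the
tree's `ShimuraCurveData.hasPeriodsIn_heckeFun` (Shimura curves, `D > 1`), run for `CartanLevelCurveData` under a `Fintype` hypothesis on the
coset space instead of `D > 1`, and recorded as an identity: with a holomorphic primitive `H` of `F`, `Σ_q H(α_q τ)` is a primitive of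
`T_n F = a F`, so `a (H(γz) − H(z)) = Σ_q [H(α_q γ z) − H(α_q z)] = Σ_q [H(δ_q α_{e q} z) − H(α_{e q} z)] = Σ_q ∫^{δ_q}`.
USE (brick 3 of this series): reduced modulo `3Λ`, the right-hand side is `n_q(Γ)·P̄(γ)` on the torus quotient (the EISENSTEIN congruence), which with
`a_ℓ(V) ≢ ℓ + 1 (mod 3)` for one good `ℓ` (tree `not_irreducible_of_frobeniusTrace_congr_off_finite`) kills the obstruction to the descent (D3).
Elementary (holomorphic primitives on `ℍ`, coset bookkeeping); the chain rule for `τ ↦ H(gτ)` and the base-point independence of periods are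
re-derived here because the tree modules `ShimuraParametrizationSplitCaseConverseProofs` ∕ `ShimuraCurvePeriodsHeckeIntegralityProofs` carrying them
have no hub olean in this file's import closure (same workaround as `…CartanEmptyDegreeIndepTransport` §1). Nothing about NUM, (D3) or any curve is
proved here; BSD is proved for no curve. [cite: ShimuraIATAF1971, §8.3 (8.3.2) and §3.3]
-- adapted from Literature/NumberTheory/Automorphic/ShimuraCurvePeriodsHeckeIntegralityProofs.lean §2, §4 (ShimuraCurveData ↦ CartanLevelCurveData)
-/

set_option linter.dupNamespace false
set_option autoImplicit false

noncomputable section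

open scoped MatrixGroups ModularForm
open UpperHalfPlane

namespace Summit.BirchSwinnertonDyer.BirchSwinnertonDyer.Theorems.CartanCover.HeckePeriod

open Literature.NumberTheory.Automorphic

/-! ## §0 The chain rule along `τ ↦ gτ` (re-derived) -/

section Analytic

variable {Γ : Subgroup (GL (Fin 2) ℝ)}

/-- **Chain rule**: if `G` is a holomorphic primitive of `F` on `ℍ` and `det g > 0`, then `v ↦ G(g·v)` is a primitive of `F ∣[2] g`
(`d(gτ)∕dτ = det g ∕ j(g,τ)²`). [folklore]
-- adapted from Literature/NumberTheory/Automorphic/ShimuraParametrizationSplitCaseConverseProofs.lean (`hasDerivAt_comp_smul_of_hasDerivAt`) -/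
theorem hasDerivAt_comp_smul (F : CuspForm Γ 2) {g : GL (Fin 2) ℝ} (hg : 0 < g.det.val) {G : ℂ → ℂ}
    (hG : ∀ z : ℂ, 0 < z.im → HasDerivAt G (F (ofComplex z)) z) {u : ℂ} (hu : 0 < u.im) :
    HasDerivAt (fun v : ℂ => G ((g • ofComplex v : ℍ) : ℂ)) ((⇑F ∣[(2 : ℤ)] g) (ofComplex u)) u := by
  have hg' : 0 < g.val.det := by rwa [← Matrix.GeneralLinearGroup.val_det_apply]
  set τ : ℍ := ofComplex u with hτdef
  have hτ : (τ : ℂ) = u := by rw [hτdef, ofComplex_apply_of_im_pos hu]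
  rw [← hτ]
  have h1 : HasDerivAt (fun v : ℂ => ((g • ofComplex v : ℍ) : ℂ)) ((g.val.det : ℂ) / denom g τ ^ 2) τ :=
    (UpperHalfPlane.hasStrictDerivAt_smul hg' τ).hasDerivAt
  have h2 : HasDerivAt G (F (ofComplex ((g • ofComplex (τ : ℂ) : ℍ) : ℂ))) ((g • ofComplex (τ : ℂ) : ℍ) : ℂ) :=
    hG _ (g • ofComplex (τ : ℂ)).im_pos
  have h3 := h2.comp (τ : ℂ) h1
  simp only [ofComplex_apply] at h3
  refine h3.congr_deriv ?_
  rw [ModularForm.slash_apply, σ_apply_of_det_pos hg, abs_of_pos hg, Matrix.GeneralLinearGroup.val_det_apply]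
  have hd : denom g τ ≠ 0 := denom_ne_zero g τ
  rw [show (2 : ℤ) - 1 = 1 by norm_num, zpow_one, zpow_neg, zpow_two]
  field_simp

end Analytic

variable {D M : ℕ} {C : Finset ℕ} (X : CartanLevelCurveData D M C)

/-! ## §1 Coset bookkeeping on `Γ∖ι(O(n))` for a Cartan datum -/

/-- Elements of `ι(O(n))` have positive determinant (`= n`, and `≠ 0`). [folklore] -/
theorem det_pos_of_mem_heckeSet {n : ℕ} {a : GL (Fin 2) ℝ} (ha : a ∈ X.heckeSet n) : 0 < a.det.val := by
  have hdet : (a : Matrix (Fin 2) (Fin 2) ℝ).det = n := ha.2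
  rw [Matrix.GeneralLinearGroup.val_det_apply, hdet]
  have h0 : (a : Matrix (Fin 2) (Fin 2) ℝ).det ≠ 0 := by
    rw [← Matrix.GeneralLinearGroup.val_det_apply]; exact a.det.ne_zero
  rw [hdet] at h0
  exact lt_of_le_of_ne (Nat.cast_nonneg n) (Ne.symm h0)

/-- **Right multiplication by `γ ∈ Γ` permutes `Γ∖ι(O(n))`**: a permutation `e` and elements `δ_q ∈ Γ` with `α_q γ = δ_q α_{e q}` for the
representatives `α_q = q.out`. [cite: ShimuraIATAF1971, §3.3] -/
theorem exists_perm_mul (n : ℕ) {γ : GL (Fin 2) ℝ} (hγ : γ ∈ X.Gamma) :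
    ∃ (e : Quotient (X.heckeSetoid n) ≃ Quotient (X.heckeSetoid n)) (δ : Quotient (X.heckeSetoid n) → GL (Fin 2) ℝ),
      (∀ q, δ q ∈ X.Gamma) ∧
      ∀ q, ((q.out : X.heckeSet n) : GL (Fin 2) ℝ) * γ = δ q * (((e q).out : X.heckeSet n) : GL (Fin 2) ℝ) := by
  -- `ι(O(n)) · Γ ⊆ ι(O(n))`
  have hmul : ∀ {a γ' : GL (Fin 2) ℝ}, a ∈ X.heckeSet n → γ' ∈ X.Gamma → a * γ' ∈ X.heckeSet n := by
    rintro a γ' ⟨⟨x, hx, hxa⟩, hdet⟩ ⟨⟨y, hy, hyγ⟩, -, hγ1⟩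
    refine ⟨⟨x * y, X.isOrder.mul_mem x hx y hy, by rw [map_mul, hxa, hyγ, Units.val_mul]⟩, ?_⟩
    rw [Units.val_mul, Matrix.det_mul, hdet, ← Matrix.GeneralLinearGroup.val_det_apply, hγ1, Units.val_one, mul_one]
  let ρ : X.heckeSet n → X.heckeSet n := fun a => ⟨a * γ, hmul a.2 hγ⟩
  let ρ' : X.heckeSet n → X.heckeSet n := fun a => ⟨a * γ⁻¹, hmul a.2 (inv_mem hγ)⟩
  have hρ : ∀ a b : X.heckeSet n, (X.heckeSetoid n) a b → (X.heckeSetoid n) (ρ a) (ρ b) := by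
    rintro a b ⟨δ, hδ, hab⟩
    exact ⟨δ, hδ, by simp only [ρ, ← mul_assoc, hab]⟩
  have hρ' : ∀ a b : X.heckeSet n, (X.heckeSetoid n) a b → (X.heckeSetoid n) (ρ' a) (ρ' b) := by
    rintro a b ⟨δ, hδ, hab⟩
    exact ⟨δ, hδ, by simp only [ρ', ← mul_assoc, hab]⟩
  let e : Quotient (X.heckeSetoid n) ≃ Quotient (X.heckeSetoid n) :=
    { toFun := Quotient.map ρ hρ
      invFun := Quotient.map ρ' hρ'
      left_inv := fun q => Quotient.inductionOn q fun a => by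
        simp only [Quotient.map_mk]
        refine congrArg _ (Subtype.ext ?_)
        simp only [ρ, ρ', mul_inv_cancel_right]
      right_inv := fun q => Quotient.inductionOn q fun a => by
        simp only [Quotient.map_mk]
        refine congrArg _ (Subtype.ext ?_)
        simp only [ρ, ρ', inv_mul_cancel_right] }
  have hδex : ∀ q : Quotient (X.heckeSetoid n), ∃ δ ∈ X.Gamma,
      ((q.out : X.heckeSet n) : GL (Fin 2) ℝ) * γ = δ * (((e q).out : X.heckeSet n) : GL (Fin 2) ℝ) := by
    intro q
    have h1 : e q = Quotient.mk _ (ρ q.out) := by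
      change Quotient.map ρ hρ q = _
      conv_lhs => rw [← Quotient.out_eq q]
      rfl
    have h2 : (X.heckeSetoid n) (e q).out (ρ q.out) := Quotient.exact (((e q).out_eq).trans h1)
    obtain ⟨δ, hδ, hδeq⟩ := h2
    refine ⟨δ, hδ, ?_⟩
    have hδeq' : δ * (((e q).out : X.heckeSet n) : GL (Fin 2) ℝ) = ((q.out : X.heckeSet n) : GL (Fin 2) ℝ) * γ := hδeq
    exact hδeq'.symm
  choose δ hδ hδeq using hδex
  exact ⟨e, δ, hδ, hδeq⟩

/-! ## §2 The identity -/

/-- Scalar multiples pass through segment integrals: `∫_z^w (a·F) = a ∫_z^w F`. [folklore] -/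
theorem segmentIntegral_smul (F : CuspForm X.Gamma 2) (a : ℂ) (z w : ℍ) :
    segmentIntegral (⇑(a • F)) z w = a * segmentIntegral F z w := by
  obtain ⟨H, hH⟩ := exists_hasDerivAt_primitive F
  have hH' : ∀ u : ℂ, 0 < u.im → HasDerivAt (fun v => a * H v) ((a • F) (ofComplex u)) u := by
    intro u hu
    rw [CuspForm.IsGLPos.smul_apply, smul_eq_mul]
    exact (hH u hu).const_mul a
  rw [segmentIntegral_eq_sub (a • F) hH' z w, segmentIntegral_eq_sub F hH z w]
  ring

/-- **THE HECKE–PERIOD IDENTITY** (Shimura (8.3.2), weight `2`, exact form). Let `Γ∖ι(O(n))` be finite, `T_n F = a·F` as functions, `γ ∈ Γ`,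
and `α_q γ = δ_q α_{e q}` as in `exists_perm_mul`. Then for every base point `z`, `a · ∫_z^{γ z} F = Σ_q ∫_z^{δ_q z} F` (only the relation `α_q γ = δ_q α_{e q}` with `δ_q ∈ Γ` is used).
[cite: ShimuraIATAF1971, §8.3 (8.3.2)] -/
theorem period_smul_eq_sum (n : ℕ) [Fintype (Quotient (X.heckeSetoid n))] (F : CuspForm X.Gamma 2) (a : ℂ)
    (hF : X.heckeFun n F = fun τ => a * F τ) {γ : GL (Fin 2) ℝ}
    (e : Quotient (X.heckeSetoid n) ≃ Quotient (X.heckeSetoid n)) (δ : Quotient (X.heckeSetoid n) → GL (Fin 2) ℝ)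
    (hδ : ∀ q, δ q ∈ X.Gamma)
    (hδeq : ∀ q, ((q.out : X.heckeSet n) : GL (Fin 2) ℝ) * γ = δ q * (((e q).out : X.heckeSet n) : GL (Fin 2) ℝ)) (z : ℍ) :
    a * segmentIntegral F z (γ • z) = ∑ q : Quotient (X.heckeSetoid n), segmentIntegral F z (δ q • z) := by
  classical
  obtain ⟨H, hH⟩ := exists_hasDerivAt_primitive F
  set α : Quotient (X.heckeSetoid n) → GL (Fin 2) ℝ := fun q => ((q.out : X.heckeSet n) : GL (Fin 2) ℝ) with hαdef
  have hαmem : ∀ q, α q ∈ X.heckeSet n := fun q => (q.out : X.heckeSet n).2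
  have hαdet : ∀ q, 0 < (α q).det.val := fun q => det_pos_of_mem_heckeSet X (hαmem q)
  -- `Σ_q H(α_q τ)` is a primitive of `T_n F = a • F`
  have hG : ∀ u : ℂ, 0 < u.im →
      HasDerivAt (fun v : ℂ => ∑ q, H ((α q • ofComplex v : ℍ) : ℂ)) ((a • F) (ofComplex u)) u := by
    intro u hu
    have hs := HasDerivAt.fun_sum (u := Finset.univ)
      (A := fun q => fun v : ℂ => H ((α q • ofComplex v : ℍ) : ℂ))
      (A' := fun q => (⇑F ∣[(2 : ℤ)] α q) (ofComplex u)) (x := u)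
      (fun q _ => hasDerivAt_comp_smul F (hαdet q) hH hu)
    have e1 : (a • F) (ofComplex u) = ∑ q, (⇑F ∣[(2 : ℤ)] α q) (ofComplex u) := by
      rw [CuspForm.IsGLPos.smul_apply, smul_eq_mul]
      have := congr_fun hF (ofComplex u)
      have hsum : X.heckeFun n F = ∑ q : Quotient (X.heckeSetoid n), (⇑F ∣[(2 : ℤ)] ((q.out : X.heckeSet n) : GL (Fin 2) ℝ)) := by
        funext τ
        simp only [CartanLevelCurveData.heckeFun, finsum_eq_sum_of_fintype, Finset.sum_apply]
      rw [hsum, Finset.sum_apply] at this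
      rw [← this]
    rw [e1]
    exact hs
  -- both sides through primitives
  have hlhs : a * segmentIntegral F z (γ • z) = segmentIntegral (⇑(a • F)) z (γ • z) := (segmentIntegral_smul X F a z (γ • z)).symm
  rw [hlhs, segmentIntegral_eq_sub (a • F) hG z (γ • z)]
  simp only [ofComplex_apply]
  have hsplit : ∀ q, H ((α q • γ • z : ℍ) : ℂ) =
      H ((α (e q) • z : ℍ) : ℂ) + segmentIntegral F (α (e q) • z) (δ q • α (e q) • z) := by
    intro q
    rw [segmentIntegral_eq_sub F hH, ← mul_smul, hδeq q, mul_smul]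
    ring
  -- periods do not depend on the base point: `∫_w^{δw} F = ∫_z^{δz} F` for `δ ∈ Γ` (`Γ`-invariance of segment integrals, tree
  -- `CartanDegree.segmentIntegral_slash_inv_smul` with `F ∣[2] δ = F`)
  have hinv : ∀ {δ' : GL (Fin 2) ℝ}, δ' ∈ X.Gamma → ∀ z' w' : ℍ, segmentIntegral F (δ' • z') (δ' • w') = segmentIntegral F z' w' := by
    intro δ' hδ' z' w'
    have hdet : 0 < δ'.det.val := by rw [Subgroup.HasDetOne.det_eq hδ', Units.val_one]; exact one_pos
    have h := CartanDegree.segmentIntegral_slash_inv_smul F hdet (δ' • z') w'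
    rw [inv_smul_smul, SlashInvariantForm.slash_action_eqn F δ' hδ'] at h
    exact h.symm
  have hper : ∀ q, segmentIntegral F (α (e q) • z) (δ q • α (e q) • z) = segmentIntegral F z (δ q • z) := by
    intro q
    have e1 := segmentIntegral_sub_segmentIntegral F z (α (e q) • z) (δ q • α (e q) • z)
    have e2 := segmentIntegral_sub_segmentIntegral F z (δ q • z) (δ q • α (e q) • z)
    have e3 := hinv (hδ q) z (α (e q) • z)
    linear_combination (-1 : ℂ) * e1 + e2 + e3
  have hsum : ((∑ q, H ((α q • γ • z : ℍ) : ℂ)) - ∑ q, H ((α q • z : ℍ) : ℂ)) = ∑ q, segmentIntegral F z (δ q • z) := by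
    simp_rw [hsplit, hper, Finset.sum_add_distrib]
    rw [Equiv.sum_comp e (fun q => H ((α q • z : ℍ) : ℂ))]
    ring
  exact hsum

end Summit.BirchSwinnertonDyer.BirchSwinnertonDyer.Theorems.CartanCover.HeckePeriod

end
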